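/-
Copyright (c) 2026 the pub-hodgecm-mathlib formalisation cell (harness21).  Prover seat hodgecm-mathlib-F0P3a-p06 (g18), 2026-09-02: TRACE IMAGE and INVERSE DIFFERENT at a
ramified CM place — the different number IS the different (wild base layer of the (D-RAM) column; census F0P3a-p06 (g17) `DUNR-H2-CENSUS.md` §4).
-/
import Literature.NumberTheory.Automorphic.RamifiedPlaceDifferent   -- ★ p850872: `valued_galAdicCompletionMap_sub_self_of_uniformizer`, `…_ne_zero`, `valued_two_mul_of_uniformizer`, `sq_ne_sq_mul_exp_neg_one`, …
import HarnessLib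

/-!
# TRACE IMAGE and INVERSE DIFFERENT at a ramified CM place: `|y + σ_w y|_w ≤ |y|_w · |σ_w τ − τ|_w · exp 1` SHARP, and
# `(∀ x ∈ 𝒪_w, Tr(x y) ∈ 𝒪_v) ⟺ |y|_w · |σ_w τ − τ|_w ≤ 1` — i.e. `Tr(𝔭_w^m) = 𝔭_v^{⌊(m+d)∕2⌋}` and `𝔇_{w∕v}^{−1} = 𝔭_w^{−d}` (any residue characteristic)
# (Serre, *Local Fields* III §3 Prop. 7, III §6 Cor. 2, IV §1 Prop. 4)

Topic `NumberTheory/Automorphic`; namespace `Literature.NumberTheory.Automorphic.UnitaryGroup`.  THEOREMS ONLY (no definition, no instance, no notation, no named fact,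
no `sorry`; axioms ⊆ {propext, Classical.choice, Quot.sound}).  Cell `pub/hodgecm-mathlib` (D-0151), crux H413 = `stmt-HodgeConjecture-24833`; half A line LH4, DYADIC
pay-down leaf `Cruxes/H413/Lines/F0_P3c_DyadicPaydown.lean`, organ (D-RAM) (PRINT by ruling D74′, scope audit LH4-plan (g5) b4c7662647f1db69 «COVERED at v ∣ 2»: BANKED base
layer, consumers none live).  HONEST LABEL: HC_CM is proved only modulo the 7 printed citations (2 remaining named inputs: hLiu418 = stmt-HodgeConjecture-24832, h413 =
stmt-HodgeConjecture-24833) until rung 0 closes; unconditional local algebra, count-neutral.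

SETTING (= ★ `RamifiedPlaceDifferent`): `L` CM, `w ∣ v` non-split with `e(w|v) ≠ 1`, `ι = toPlace v w`, `σ = σ_w`, `τ` a uniformiser, `τ + στ = ι u₀`, `D := |στ − τ|_w =
exp(−d)` (★ `exists_different_of_ramified`).  The TRACE is `Tr y := y + σ y ∈ ι(L⁺_v)`; in the Eisenstein basis `Tr(ι p + ι q τ) = ι(2p + q u₀)`.  ★ `RamifiedPlaceDifferent`
defined `d` as `ord_w(στ − τ) = i_G(σ)`; THIS file proves it is the different in the two classical senses: (i) the trace image `Tr(𝔭_w^m) = 𝔭_v^{⌊(m+d)∕2⌋}` (Serre III §3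
Prop. 7: `Tr(𝔭_L^m) = 𝔭_K^r`, `r = ⌊(d + m)∕e⌋`), here as the SHARP valuation bound `|Tr y|_w ≤ |y|_w·D·exp 1` with equality attained for every target `ι c`; (ii) the
inverse different `{y : Tr(y 𝒪_w) ⊆ 𝒪_v} = 𝔭_w^{−d}`, i.e. `𝔇_{w∕v} = 𝔭_w^d = (στ − τ)`.
* §1 `add_galAdicCompletionMap_toPlace_add_toPlace_mul` (`Tr(ι p + ι q τ) = ι(2p + q u₀)`), `exists_toPlace_eq_add_galAdicCompletionMap` (`Tr y ∈ ι L⁺_v`),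
  `valued_add_galAdicCompletionMap_ne_exp_odd` (trace values have even exponent).
* §2 **`valued_add_galAdicCompletionMap_le`** — `|y + σy| ≤ |y| · |στ − τ| · exp 1` for all `y` (Serre III §3 Prop. 7, «⊆»);
  **`exists_add_galAdicCompletionMap_eq_toPlace`** — for every `c ∈ L⁺_v` a preimage `y` with `y + σy = ι c` and `|y| · |στ − τ| · exp 1 = |ι c|` («⊇», SHARP: `y = ι(c∕2)` when
  `d` is odd, `y = ι(c∕u₀)·τ` when `d` is even).
* §3 **`forall_valued_add_galAdicCompletionMap_mul_le_one_iff`** — `(∀ x, |x| ≤ 1 → |x y + σ(x y)| ≤ 1) ↔ |y| · |στ − τ| ≤ 1`: THE INVERSE DIFFERENT IS `𝔭_w^{−d}`.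
* §4 package `exists_different_traceDual_of_ramified` (`∃ d ≥ 1`, the four clauses with `exp(−d)`).

## References
* [Serre1979] J.-P. Serre, *Local Fields*, GTM 67 (1979): Ch. III §3 Prop. 7 (`Tr(𝔭_L^m) = 𝔭_K^{⌊(m+d)∕e⌋}`), Ch. III §6 Cor. 2 (`𝔇 = (g′(τ))`), Ch. IV §1 Prop. 4.
* [NeukirchANT1999] J. Neukirch, *Algebraic Number Theory* (1999): Ch. III §2 (2.1)–(2.4) (inverse different as trace dual; different of a monogenic order).
-/

set_option autoImplicit false

noncomputable section

open NumberField IsDedekindDomain ValuativeRel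
open scoped ValuativeRel WithZero

namespace Literature.NumberTheory.Automorphic.UnitaryGroup

variable (L : Type) [Field L] [NumberField L] [IsCMField L] (v : HeightOneSpectrum (𝓞 ↥(maximalRealSubfield L)))
  (w : PlacesOver L v) (hw : IsCMField.complexConj L • w.1 = w.1) (he : v.asIdeal.ramificationIdx' w.1.asIdeal ≠ 1)

/-! ## §1 The trace `y + σ y` in the Eisenstein basis -/

/-- **`Tr(ι p + ι q τ) = ι(2p + q u₀)`** when `τ + στ = ι u₀`. [cite: Serre1979, Ch. III §3] -/
theorem add_galAdicCompletionMap_toPlace_add_toPlace_mul {τ : w.1.adicCompletion L} {u₀ : v.adicCompletion ↥(maximalRealSubfield L)}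
    (htr : τ + galAdicCompletionMap (L := L) (IsCMField.complexConj L) hw τ = toPlace v w u₀) (p q : v.adicCompletion ↥(maximalRealSubfield L)) :
    (toPlace v w p + toPlace v w q * τ) + galAdicCompletionMap (L := L) (IsCMField.complexConj L) hw (toPlace v w p + toPlace v w q * τ) =
      toPlace v w (2 * p + q * u₀) := by
  rw [galAdicCompletionMap_toPlace_add_toPlace_mul L v w hw τ p q, map_add, map_mul, map_mul, map_ofNat, ← htr]
  ring

/-- **`Tr y ∈ ι(L⁺_v)`**: `y + σy` is `σ`-fixed, hence descends (★ `exists_toPlace_eq_of_galAdicCompletionMap_eq`). [cite: Serre1979, Ch. III §3] -/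
theorem exists_toPlace_eq_add_galAdicCompletionMap (y : w.1.adicCompletion L) :
    ∃ c : v.adicCompletion ↥(maximalRealSubfield L), toPlace v w c = y + galAdicCompletionMap (L := L) (IsCMField.complexConj L) hw y := by
  have hc1 : IsCMField.complexConj L ≠ 1 := IsCMField.complexConj_ne_one L
  refine exists_toPlace_eq_of_galAdicCompletionMap_eq (IsCMField.complexConj L) w hc1 hw _ ?_
  rw [map_add, galAdicCompletionMap_galAdicCompletionMap_of_smul_eq (IsCMField.complexConj L) w hc1 hw, add_comm]

include he in
/-- Trace values have EVEN exponent: `|y + σy| ≠ exp(2k − 1)` (they lie in `ι L⁺_v`, ★ `valued_toPlace_eq_sq_of_ramified`). [cite: Serre1979, Ch. II §2] -/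
theorem valued_add_galAdicCompletionMap_ne_exp_odd (y : w.1.adicCompletion L) (k : ℤ) :
    Valued.v (y + galAdicCompletionMap (L := L) (IsCMField.complexConj L) hw y) ≠ WithZero.exp (2 * k - 1) := by
  obtain ⟨c, hc⟩ := exists_toPlace_eq_add_galAdicCompletionMap L v w hw y
  rw [← hc, valued_toPlace_eq_sq_of_ramified L v w hw he]
  intro h
  rcases eq_or_ne c 0 with hc0 | hc0
  · rw [hc0, map_zero, zero_pow two_ne_zero] at h; exact WithZero.zero_ne_coe h
  obtain ⟨m, hm⟩ : ∃ m : ℤ, Valued.v c = WithZero.exp m := ⟨_, (WithZero.exp_log ((Valuation.ne_zero_iff _).2 hc0)).symm⟩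
  rw [hm, ← WithZero.exp_nsmul, WithZero.exp_inj] at h
  simp only [nsmul_eq_mul, Nat.cast_ofNat] at h
  omega

/-! ## §2 The trace image: `Tr(𝔭_w^m) = 𝔭_v^{⌊(m+d)∕2⌋}` as a sharp valuation bound -/

include he in
/-- **TRACE BOUND («⊆» of Serre III §3 Prop. 7): `|y + σy| ≤ |y| · |στ − τ| · exp 1`** for every `y ∈ L_w` and every uniformiser `τ`.  (In the basis: `Tr(ι p + ι q τ) = ι(2p) +
ι(q u₀)` with `|ι(2p)| = |2|_w|p|² ≤ (D·e)·|y|` since `|2|_w = |2τ|·e ≤ D·e`, and `|ι(q u₀)| = |q|²·|ι u₀| ≤ |q|²·D = (|q|²e⁻¹)·D·e ≤ |y|·D·e`.)  In exponents: `v_w(Tr y) ≥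
v_w(y) + d − 1`, and since trace values are even, `v_v(Tr y) ≥ ⌊(v_w(y) + d)∕2⌋`. [cite: Serre1979, Ch. III §3 Prop. 7] -/
theorem valued_add_galAdicCompletionMap_le {τ : w.1.adicCompletion L} (hτ : Valued.v τ = WithZero.exp (-1 : ℤ)) (y : w.1.adicCompletion L) :
    Valued.v (y + galAdicCompletionMap (L := L) (IsCMField.complexConj L) hw y) ≤
      Valued.v y * Valued.v (galAdicCompletionMap (L := L) (IsCMField.complexConj L) hw τ - τ) * WithZero.exp (1 : ℤ) := by
  obtain ⟨u₀, v₀, htr, -, -, -⟩ := exists_eisenstein_coeffs_of_ramified L v w hw he hτ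
  obtain ⟨p, q, rfl⟩ := exists_eq_toPlace_add_toPlace_mul L v w hw he hτ y
  set D := Valued.v (galAdicCompletionMap (L := L) (IsCMField.complexConj L) hw τ - τ) with hDdef
  have hD : D = max (Valued.v (toPlace v w u₀)) (Valued.v (2 * τ)) := valued_galAdicCompletionMap_sub_self_of_uniformizer L v w hw he hτ htr
  have hy : Valued.v (toPlace v w p + toPlace v w q * τ) = max (Valued.v p ^ 2) (Valued.v q ^ 2 * WithZero.exp (-1 : ℤ)) :=
    valued_toPlace_add_toPlace_mul L v w hw he hτ p q
  have he1 : WithZero.exp (-1 : ℤ) * WithZero.exp (1 : ℤ) = 1 := by rw [← WithZero.exp_add]; norm_num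
  rw [add_galAdicCompletionMap_toPlace_add_toPlace_mul L v w hw htr p q, map_add]
  refine (Valuation.map_add _ _ _).trans (max_le ?_ ?_)
  · -- `|ι(2p)| = |2|_w |p|² ≤ |y|·D·e`
    rw [map_mul, map_mul, map_ofNat, valued_toPlace_eq_sq_of_ramified L v w hw he p]
    have h2 : Valued.v (2 : w.1.adicCompletion L) ≤ D * WithZero.exp (1 : ℤ) := by
      have h2τ : Valued.v (2 * τ) ≤ D := by rw [hD]; exact le_max_right _ _
      rw [map_mul, hτ] at h2τ
      calc Valued.v (2 : w.1.adicCompletion L) = Valued.v (2 : w.1.adicCompletion L) * WithZero.exp (-1 : ℤ) * WithZero.exp (1 : ℤ) := by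
            rw [mul_assoc, he1, mul_one]
        _ ≤ D * WithZero.exp (1 : ℤ) := by gcongr
    have hp : Valued.v p ^ 2 ≤ Valued.v (toPlace v w p + toPlace v w q * τ) := by rw [hy]; exact le_max_left _ _
    calc Valued.v (2 : w.1.adicCompletion L) * Valued.v p ^ 2 ≤ (D * WithZero.exp (1 : ℤ)) * Valued.v (toPlace v w p + toPlace v w q * τ) := by gcongr
      _ = _ := by rw [mul_comm (D * WithZero.exp (1 : ℤ)), mul_assoc]
  · -- `|ι(q u₀)| = |q|²·|ι u₀| ≤ |y|·D·e`
    rw [map_mul, map_mul, valued_toPlace_eq_sq_of_ramified L v w hw he q]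
    have hu : Valued.v (toPlace v w u₀) ≤ D := by rw [hD]; exact le_max_left _ _
    have hq : Valued.v q ^ 2 * WithZero.exp (-1 : ℤ) ≤ Valued.v (toPlace v w p + toPlace v w q * τ) := by rw [hy]; exact le_max_right _ _
    have hrw : Valued.v q ^ 2 * Valued.v (toPlace v w u₀) = (Valued.v q ^ 2 * WithZero.exp (-1 : ℤ)) * Valued.v (toPlace v w u₀) * WithZero.exp (1 : ℤ) := by
      calc Valued.v q ^ 2 * Valued.v (toPlace v w u₀) = Valued.v q ^ 2 * Valued.v (toPlace v w u₀) * (WithZero.exp (-1 : ℤ) * WithZero.exp (1 : ℤ)) := by rw [he1, mul_one]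
        _ = (Valued.v q ^ 2 * WithZero.exp (-1 : ℤ)) * Valued.v (toPlace v w u₀) * WithZero.exp (1 : ℤ) := by
          simp only [mul_assoc, mul_comm (Valued.v (toPlace v w u₀))]
    rw [hrw]
    gcongr

include he in
/-- **TRACE PREIMAGES («⊇» of Serre III §3 Prop. 7, SHARP): for every `c ∈ L⁺_v` there is `y ∈ L_w` with `y + σy = ι c` and `|y| · |στ − τ| · exp 1 = |ι c|`** —
`y = ι(c∕2)` when `|στ − τ| = |2τ|` (`d` odd), `y = ι(c∕u₀)·τ` when `|στ − τ| = |ι u₀|` (`d` even); together with the bound, `Tr(𝔭_w^m) = 𝔭_v^{⌊(m+d)∕2⌋}` exactly.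
[cite: Serre1979, Ch. III §3 Prop. 7] -/
theorem exists_add_galAdicCompletionMap_eq_toPlace {τ : w.1.adicCompletion L} (hτ : Valued.v τ = WithZero.exp (-1 : ℤ)) (c : v.adicCompletion ↥(maximalRealSubfield L)) :
    ∃ y : w.1.adicCompletion L, y + galAdicCompletionMap (L := L) (IsCMField.complexConj L) hw y = toPlace v w c ∧
      Valued.v y * Valued.v (galAdicCompletionMap (L := L) (IsCMField.complexConj L) hw τ - τ) * WithZero.exp (1 : ℤ) = Valued.v (toPlace v w c) := by
  obtain ⟨u₀, v₀, htr, -, -, -⟩ := exists_eisenstein_coeffs_of_ramified L v w hw he hτ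
  have hval := valued_galAdicCompletionMap_sub_self_of_uniformizer L v w hw he hτ htr
  have hσι : ∀ x, galAdicCompletionMap (L := L) (IsCMField.complexConj L) hw (toPlace v w x) = toPlace v w x :=
    fun x => galAdicCompletionMap_toPlace (IsCMField.complexConj L) w w hw x
  have he1 : WithZero.exp (-1 : ℤ) * WithZero.exp (1 : ℤ) = 1 := by rw [← WithZero.exp_add]; norm_num
  have h2v : (2 : v.adicCompletion ↥(maximalRealSubfield L)) ≠ 0 := by
    rw [show (2 : v.adicCompletion ↥(maximalRealSubfield L)) = algebraMap ↥(maximalRealSubfield L) _ 2 by rw [map_ofNat]]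
    exact (_root_.map_ne_zero (algebraMap ↥(maximalRealSubfield L) (v.adicCompletion ↥(maximalRealSubfield L)))).2 two_ne_zero
  rcases le_total (Valued.v (toPlace v w u₀)) (Valued.v (2 * τ)) with hle | hle
  · -- odd: `D = |2τ|`, `y = ι(c/2)`
    have hD : Valued.v (galAdicCompletionMap (L := L) (IsCMField.complexConj L) hw τ - τ) = Valued.v (2 * τ) := by rw [hval, max_eq_right hle]
    refine ⟨toPlace v w (c / 2), ?_, ?_⟩
    · rw [hσι, ← map_add]; congr 1; rw [← add_div, ← two_mul, mul_div_cancel_left₀ _ h2v]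
    · rw [hD, map_mul, hτ]
      rcases eq_or_ne c 0 with hc0 | hc0
      · rw [hc0, zero_div, map_zero, map_zero, zero_mul, zero_mul]
      have h2w : (2 : w.1.adicCompletion L) ≠ 0 := by rw [← map_ofNat (toPlace v w) 2]; exact (_root_.map_ne_zero _).2 h2v
      obtain ⟨a, ha⟩ : ∃ a : ℤ, Valued.v (toPlace v w c) = WithZero.exp a := ⟨_, (WithZero.exp_log ((Valuation.ne_zero_iff _).2 ((_root_.map_ne_zero _).2 hc0))).symm⟩
      obtain ⟨b, hb⟩ : ∃ b : ℤ, Valued.v (2 : w.1.adicCompletion L) = WithZero.exp b := ⟨_, (WithZero.exp_log ((Valuation.ne_zero_iff _).2 h2w)).symm⟩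
      simp only [map_div₀, map_ofNat, ha, hb, ← WithZero.exp_sub, ← WithZero.exp_add, WithZero.exp_inj]
      ring
  · -- even: `D = |ι u₀|`, `u₀ ≠ 0`, `y = ι(c/u₀)·τ`
    have hD : Valued.v (galAdicCompletionMap (L := L) (IsCMField.complexConj L) hw τ - τ) = Valued.v (toPlace v w u₀) := by rw [hval, max_eq_left hle]
    have hu0 : u₀ ≠ 0 := by
      rintro rfl
      rw [map_zero, map_zero] at hD
      exact valued_galAdicCompletionMap_sub_self_ne_zero L v w hw he hτ hD
    have hιu : toPlace v w u₀ ≠ 0 := (_root_.map_ne_zero _).2 hu0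
    refine ⟨toPlace v w (c / u₀) * τ, ?_, ?_⟩
    · have h1 : toPlace v w (c / u₀) * τ + galAdicCompletionMap (L := L) (IsCMField.complexConj L) hw (toPlace v w (c / u₀) * τ) =
          toPlace v w (c / u₀) * (τ + galAdicCompletionMap (L := L) (IsCMField.complexConj L) hw τ) := by rw [map_mul, hσι, mul_add]
      rw [h1, htr, ← map_mul, div_mul_cancel₀ _ hu0]
    · rw [hD, map_mul, hτ]
      rcases eq_or_ne c 0 with hc0 | hc0
      · rw [hc0, zero_div, map_zero, map_zero, zero_mul, zero_mul, zero_mul]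
      obtain ⟨a, ha⟩ : ∃ a : ℤ, Valued.v (toPlace v w c) = WithZero.exp a := ⟨_, (WithZero.exp_log ((Valuation.ne_zero_iff _).2 ((_root_.map_ne_zero _).2 hc0))).symm⟩
      obtain ⟨b, hb⟩ : ∃ b : ℤ, Valued.v (toPlace v w u₀) = WithZero.exp b := ⟨_, (WithZero.exp_log ((Valuation.ne_zero_iff _).2 hιu)).symm⟩
      simp only [map_div₀, ha, hb, ← WithZero.exp_sub, ← WithZero.exp_add, WithZero.exp_inj]
      ring

/-! ## §3 The inverse different is `𝔭_w^{−d}` -/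

include he in
/-- A trace value of valuation `≤ exp 1` is integral (even exponent). [cite: Serre1979, Ch. II §2] -/
theorem valued_add_galAdicCompletionMap_le_one_of_le_exp_one {y : w.1.adicCompletion L}
    (h : Valued.v (y + galAdicCompletionMap (L := L) (IsCMField.complexConj L) hw y) ≤ WithZero.exp (1 : ℤ)) :
    Valued.v (y + galAdicCompletionMap (L := L) (IsCMField.complexConj L) hw y) ≤ 1 := by
  rcases h.lt_or_eq with hlt | heq
  · rcases eq_or_ne (Valued.v (y + galAdicCompletionMap (L := L) (IsCMField.complexConj L) hw y)) 0 with h0 | h0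
    · rw [h0]; exact zero_le
    obtain ⟨m, hm⟩ : ∃ m : ℤ, Valued.v (y + galAdicCompletionMap (L := L) (IsCMField.complexConj L) hw y) = WithZero.exp m := ⟨_, (WithZero.exp_log h0).symm⟩
    rw [hm, WithZero.exp_lt_exp] at hlt
    rw [hm, ← WithZero.exp_zero, WithZero.exp_le_exp]; omega
  · exact absurd heq (by simpa using valued_add_galAdicCompletionMap_ne_exp_odd L v w hw he y 1)

include he in
/-- **THE INVERSE DIFFERENT IS `𝔭_w^{−d}`**: for `y ∈ L_w`, `Tr(y·𝒪_w) ⊆ 𝒪_v` — i.e. `|x y + σ(x y)| ≤ 1` for all `x ∈ 𝒪_w` — iff `|y| · |στ − τ| ≤ 1`.  (⇐: §2 bound gives `|Tr(xy)| ≤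
exp 1`, and trace values are even; ⇒: if `|y|·D ≥ exp 1`, the sharp preimage `y′` of `ι ϖ_v⁻¹` has `|y′| = exp 2∕(D·e) ≤ |y|`, so `x := y′∕y ∈ 𝒪_w` gives `Tr(xy) = ι ϖ_v⁻¹ ∉
𝒪_v`.)  Hence `𝔇_{w∕v} = 𝔭_w^d = (στ − τ)·𝒪_w`: the different NUMBER of ★ `RamifiedPlaceDifferent` is the different. [cite: Serre1979, Ch. III §3 Prop. 7, Ch. III §6 Cor. 2] [cite: NeukirchANT1999, Ch. III §2 (2.1)–(2.4)] -/
theorem forall_valued_add_galAdicCompletionMap_mul_le_one_iff {τ : w.1.adicCompletion L} (hτ : Valued.v τ = WithZero.exp (-1 : ℤ)) (y : w.1.adicCompletion L) :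
    (∀ x : w.1.adicCompletion L, Valued.v x ≤ 1 → Valued.v (x * y + galAdicCompletionMap (L := L) (IsCMField.complexConj L) hw (x * y)) ≤ 1) ↔
      Valued.v y * Valued.v (galAdicCompletionMap (L := L) (IsCMField.complexConj L) hw τ - τ) ≤ 1 := by
  set D := Valued.v (galAdicCompletionMap (L := L) (IsCMField.complexConj L) hw τ - τ) with hDdef
  have hD0 : D ≠ 0 := valued_galAdicCompletionMap_sub_self_ne_zero L v w hw he hτ
  constructor
  · intro h
    by_contra hlt
    rw [not_le] at hlt
    -- a uniformiser `ϖ_v` of `L⁺_v` and the sharp preimage `y′` of `ι ϖ_v⁻¹`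
    obtain ⟨π, hπ⟩ := v.valuation_exists_uniformizer ↥(maximalRealSubfield L)
    have hϖ : Valued.v (π : v.adicCompletion ↥(maximalRealSubfield L)) = WithZero.exp (-1 : ℤ) := by
      rw [HeightOneSpectrum.valuedAdicCompletion_eq_valuation', hπ]
    obtain ⟨y', hy'tr, hy'v⟩ := exists_add_galAdicCompletionMap_eq_toPlace L v w hw he hτ ((π : v.adicCompletion ↥(maximalRealSubfield L))⁻¹)
    have hιπ : Valued.v (toPlace v w ((π : v.adicCompletion ↥(maximalRealSubfield L))⁻¹)) = WithZero.exp (2 : ℤ) := by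
      rw [valued_toPlace_eq_sq_of_ramified L v w hw he, map_inv₀, hϖ, ← WithZero.exp_neg, ← WithZero.exp_nsmul]; norm_num
    -- `|y′| ≤ |y|`: `|y′|·D·e = exp 2` and `|y|·D ≥ exp 1`
    have hy0 : y ≠ 0 := by
      rintro rfl; rw [map_zero, zero_mul] at hlt; exact not_lt_zero hlt
    have hle : Valued.v y' ≤ Valued.v y := by
      rw [hιπ] at hy'v
      obtain ⟨m, hm⟩ : ∃ m : ℤ, Valued.v y * D = WithZero.exp m := ⟨_, (WithZero.exp_log (mul_ne_zero ((Valuation.ne_zero_iff _).2 hy0) hD0)).symm⟩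
      have hm1 : 1 ≤ m := by rw [hm, ← WithZero.exp_zero, WithZero.exp_lt_exp] at hlt; omega
      -- compare `|y′|·D` with `|y|·D`
      have hy'D : Valued.v y' * D = WithZero.exp (1 : ℤ) := by
        have := hy'v
        calc Valued.v y' * D = Valued.v y' * D * WithZero.exp (1 : ℤ) * WithZero.exp (-1 : ℤ) := by rw [mul_assoc (Valued.v y' * D), ← WithZero.exp_add]; norm_num
          _ = WithZero.exp (2 : ℤ) * WithZero.exp (-1 : ℤ) := by rw [this]
          _ = WithZero.exp (1 : ℤ) := by rw [← WithZero.exp_add]; norm_num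
      have : Valued.v y' * D ≤ Valued.v y * D := by rw [hy'D, hm, WithZero.exp_le_exp]; exact hm1
      exact le_of_mul_le_mul_right this (zero_lt_iff.2 hD0)
    -- `x := y′ / y ∈ 𝒪_w`, `Tr(x y) = Tr y′ = ι ϖ_v⁻¹` of valuation `exp 2 > 1`
    have hx : Valued.v (y' / y) ≤ 1 := by rw [map_div₀, div_le_one₀ (zero_lt_iff.2 ((Valuation.ne_zero_iff _).2 hy0))]; exact hle
    have hbad := h (y' / y) hx
    rw [div_mul_cancel₀ _ hy0, hy'tr, hιπ, ← WithZero.exp_zero, WithZero.exp_le_exp] at hbad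
    omega
  · intro hyD x hx
    apply valued_add_galAdicCompletionMap_le_one_of_le_exp_one L v w hw he
    refine (valued_add_galAdicCompletionMap_le L v w hw he hτ (x * y)).trans ?_
    rw [map_mul]
    calc Valued.v x * Valued.v y * D * WithZero.exp (1 : ℤ) ≤ 1 * 1 * WithZero.exp (1 : ℤ) := by
          rw [mul_assoc (Valued.v x)]; gcongr
      _ = WithZero.exp (1 : ℤ) := by rw [one_mul, one_mul]

/-! ## §4 One package -/

include he in
/-- **THE DIFFERENT NUMBER IS THE DIFFERENT — ONE PACKAGE.**  At a ramified place `w ∣ v` of the CM extension `L ∕ L⁺` (any residue characteristic) there is `d : ℕ`, `1 ≤ d`, with: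
`|στ − τ| = exp(−d)` for every uniformiser `τ`; the TRACE BOUND `|y + σy| ≤ |y| · exp(1 − d)`; SHARP PREIMAGES `∀ c, ∃ y, y + σy = ι c ∧ |y| · exp(1 − d) = |ι c|` (so `Tr(𝔭_w^m) =
𝔭_v^{⌊(m+d)∕2⌋}`); and the INVERSE DIFFERENT `(∀ x ∈ 𝒪_w, |xy + σ(xy)| ≤ 1) ↔ |y| ≤ exp d` (`𝔇_{w∕v} = 𝔭_w^d`).
[cite: Serre1979, Ch. III §3 Prop. 7, Ch. III §6 Cor. 2, Ch. IV §1 Prop. 4] [cite: NeukirchANT1999, Ch. III §2 (2.1)–(2.4)] -/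
theorem exists_different_traceDual_of_ramified :
    ∃ d : ℕ, 1 ≤ d ∧
      (∀ τ : w.1.adicCompletion L, Valued.v τ = WithZero.exp (-1 : ℤ) →
        Valued.v (galAdicCompletionMap (L := L) (IsCMField.complexConj L) hw τ - τ) = WithZero.exp (-(d : ℤ))) ∧
      (∀ y : w.1.adicCompletion L, Valued.v (y + galAdicCompletionMap (L := L) (IsCMField.complexConj L) hw y) ≤ Valued.v y * WithZero.exp (1 - (d : ℤ))) ∧
      (∀ c : v.adicCompletion ↥(maximalRealSubfield L), ∃ y : w.1.adicCompletion L,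
        y + galAdicCompletionMap (L := L) (IsCMField.complexConj L) hw y = toPlace v w c ∧ Valued.v y * WithZero.exp (1 - (d : ℤ)) = Valued.v (toPlace v w c)) ∧
      (∀ y : w.1.adicCompletion L,
        (∀ x : w.1.adicCompletion L, Valued.v x ≤ 1 → Valued.v (x * y + galAdicCompletionMap (L := L) (IsCMField.complexConj L) hw (x * y)) ≤ 1) ↔
          Valued.v y ≤ WithZero.exp (d : ℤ)) := by
  obtain ⟨d, hd1, hdτ, -, -, -, -, -⟩ := exists_different_of_ramified L v w hw he
  obtain ⟨π, hπ⟩ := w.1.valuation_exists_uniformizer L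
  have hτ : Valued.v (π : w.1.adicCompletion L) = WithZero.exp (-1 : ℤ) := by rw [HeightOneSpectrum.valuedAdicCompletion_eq_valuation', hπ]
  have hD := hdτ _ hτ
  have hexp : WithZero.exp (-(d : ℤ)) * WithZero.exp (1 : ℤ) = WithZero.exp (1 - (d : ℤ)) := by rw [← WithZero.exp_add]; ring_nf
  refine ⟨d, hd1, hdτ, fun y => ?_, fun c => ?_, fun y => ?_⟩
  · have h := valued_add_galAdicCompletionMap_le L v w hw he hτ y
    rwa [hD, mul_assoc, hexp] at h
  · obtain ⟨y, hy, hyv⟩ := exists_add_galAdicCompletionMap_eq_toPlace L v w hw he hτ c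
    exact ⟨y, hy, by rw [← hyv, hD, mul_assoc, hexp]⟩
  · rw [forall_valued_add_galAdicCompletionMap_mul_le_one_iff L v w hw he hτ y, hD]
    rcases eq_or_ne y 0 with hy0 | hy0
    · rw [hy0, map_zero, zero_mul]; exact ⟨fun _ => zero_le, fun _ => zero_le⟩
    obtain ⟨m, hm⟩ : ∃ m : ℤ, Valued.v y = WithZero.exp m := ⟨_, (WithZero.exp_log ((Valuation.ne_zero_iff _).2 hy0)).symm⟩
    rw [hm, ← WithZero.exp_add, ← WithZero.exp_zero, WithZero.exp_le_exp, WithZero.exp_le_exp]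
    omega

end Literature.NumberTheory.Automorphic.UnitaryGroup

end
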